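/-
Copyright (c) 2026. All rights reserved.
Released under Apache 2.0 license as described in the file LICENSE.
Authors: abc-iut cell — seat abc-iut-f-060 (block F fact-proving wave, tranche 60 of plan/F-TRANCHES.tsv:
FACT-LIST row F-0214 `ChainGroup.KerTopNormallyGeneratedBy` of `AbsTopIChains.lean`).
-/
import Literature.AnabelianGeometry.AbsoluteAnabelian.AbsTopI.TargetDataNonVacuity
import HarnessLib

/-!
# [AbsTopI] Def 4.2 (iii), the kernel clause `KerTopNormallyGeneratedBy`: a VOCABULARY row — both truth
# values occur, the universal closure is REFUTED

S. Mochizuki, *Topics in Absolute Anabelian Geometry I: Generalities* [MochizukiAbsTopI2012], Def 4.2 (iii)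
p. 50, operations (c) de-cuspidalization and (d) de-orbification: "the kernel of `Πⱼ ↠ Πⱼ₊₁` is topologically
normally generated by" a cuspidal decomposition group, resp. a finite closed subgroup, "`⊆ Δⱼ`".  The parent file
`AbsTopIChains.lean` (abc-iut-L4-t4) types the clause as the predicate
`ChainGroup.KerTopNormallyGeneratedBy φ A : Ker φ = (normal closure of A)^{top. closure}` and CONSUMES it inside the
definition `ChainGroup.IsElemOp` (cases `.deCusp`, `.deOrb`); the cell's FACT-LIST lists it as row F-0214 because
its docstring cites the item (status «conditional» only through the transport lemma
`AbsTopI.kerTopNormallyGeneratedBy_transfer` of `ChainTransport.lean`, whose conclusion has this head).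

This PROOF-ONLY companion file (no `def` / `instance` / `structure`) records that the row is a DEFINITION
(vocabulary), not an assumable fact:

* for the identity operation homomorphism the clause holds for `A` iff the closed normal closure of `A` is
  trivial (`kerTopNormallyGeneratedBy_id_iff`) — so it HOLDS for `A = 1` (`kerTopNormallyGeneratedBy_id_bot`) and
  FAILS for `A = Πⱼ` on every chain group (`not_kerTopNormallyGeneratedBy_id_top`; chain groups are non-trivial
  by (2_Π) `Δⱼ ≠ 1`);
* hence over every extension carrying the slimness inputs (0_Π)–(2_Π) of Def 4.2 (iii) some instance fails
  (`exists_not_kerTopNormallyGeneratedBy`), and the universal closure is false outright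
  (`not_forall_kerTopNormallyGeneratedBy`, instantiated at abc-iut-w5-d197's genuine-in-group-theory target
  `Π := G_{ℚ_2} × F̂₂ ↠ G_{ℚ_2}` of `AbsTopI.TargetData.exists_slim_prod`, whose slimness rests on the tree's
  PROVED [pGC] Lemma 15.8 for `ℚ_2` and the PROVED slimness of `F̂₂`).

Consequence for consumers (plan rule R5): nothing to assume — the clause is part of the MEANING of "elementary
operation of type •/⊚"; a consumer proves it for the operation homomorphism it constructs.

HONEST FRAMING: a statement about the cell's typed vocabulary over abstract data; nothing of [AbsTopI] is asserted;
no side is taken on [IUTchIII] Cor. 3.12; typed ≠ proved.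
-/

namespace Literature.AnabelianGeometry.AbsoluteAnabelian

open Literature.AlgebraicGeometry.Frobenioids (IsSlimGroup)

universe u

namespace FundamentalExtension

namespace ChainGroup

variable {E : FundamentalExtension.{u}}

/-- For the identity `Πⱼ → Πⱼ` (kernel `1`), "the kernel is topologically normally generated by `A`" holds iff
the closed normal closure of `A` is trivial. [cite: MochizukiAbsTopI2012, Def 4.2 (iii) p.50] -/
theorem kerTopNormallyGeneratedBy_id_iff (L : E.ChainGroup) (A : Subgroup L.grp) :
    KerTopNormallyGeneratedBy (ContinuousMonoidHom.id L.grp) A ↔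
      (Subgroup.normalClosure (A : Set L.grp)).topologicalClosure = ⊥ := by
  unfold KerTopNormallyGeneratedBy
  rw [show (ContinuousMonoidHom.id L.grp).toMonoidHom.ker = ⊥ from MonoidHom.ker_id, eq_comm]

/-- The clause HOLDS for the identity and `A = 1` (the closed normal closure of `1` is `1`: `Πⱼ` is Hausdorff).
[cite: MochizukiAbsTopI2012, Def 4.2 (iii) p.50] -/
theorem kerTopNormallyGeneratedBy_id_bot (L : E.ChainGroup) :
    KerTopNormallyGeneratedBy (ContinuousMonoidHom.id L.grp) (⊥ : Subgroup L.grp) := by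
  rw [kerTopNormallyGeneratedBy_id_iff, eq_bot_iff]
  refine Subgroup.topologicalClosure_minimal _ ?_ ?_
  · exact Subgroup.normalClosure_le_normal (by simp)
  · rw [Subgroup.coe_bot]
    exact isClosed_singleton

/-- Every term `Πⱼ` of a Π-chain is a non-trivial group: (2_Π) says `Δⱼ = Ker(Πⱼ → G) ≠ 1`.
[cite: MochizukiAbsTopI2012, Def 4.2 (iii) p.49] -/
theorem nontrivial_grp (L : E.ChainGroup) : Nontrivial L.grp := by
  haveI : Nontrivial L.proj.toMonoidHom.ker := (Subgroup.nontrivial_iff_ne_bot _).mpr L.ker_ne_bot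
  exact Function.Injective.nontrivial
    (Subtype.val_injective : Function.Injective (Subtype.val : L.proj.toMonoidHom.ker → L.grp))

/-- The clause FAILS for the identity and `A = Πⱼ` on every chain group (the closed normal closure of `Πⱼ` is
`Πⱼ ≠ 1`). [cite: MochizukiAbsTopI2012, Def 4.2 (iii) p.50] -/
theorem not_kerTopNormallyGeneratedBy_id_top (L : E.ChainGroup) :
    ¬ KerTopNormallyGeneratedBy (ContinuousMonoidHom.id L.grp) (⊤ : Subgroup L.grp) := by
  rw [kerTopNormallyGeneratedBy_id_iff]
  haveI := L.nontrivial_grp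
  have htop : (Subgroup.normalClosure ((⊤ : Subgroup L.grp) : Set L.grp)).topologicalClosure = ⊤ :=
    top_le_iff.mp (le_trans Subgroup.le_normalClosure (Subgroup.le_topologicalClosure _))
  rw [htop]
  exact top_ne_bot

/-- **F-0214 is vocabulary (strong form)**: over every extension carrying the slimness inputs (0_Π)–(2_Π) of
Def 4.2 (iii) (`Π` slim, `Δ` slim, `Δ ≠ 1`) there are a chain group (namely `Π₀ = Π`), an operation
homomorphism (the identity) and a subgroup (`Π` itself) for which the kernel clause fails.
[cite: MochizukiAbsTopI2012, Def 4.2 (iii) p.50] -/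
theorem exists_not_kerTopNormallyGeneratedBy (hP : IsSlimGroup E.arith) (hΔ : IsSlimGroup E.geom)
    (hne : E.geom ≠ ⊥) :
    ∃ (L : E.ChainGroup) (φ : L.grp →ₜ* L.grp) (A : Subgroup L.grp), ¬ KerTopNormallyGeneratedBy φ A :=
  ⟨ChainGroup.self hP hΔ hne, ContinuousMonoidHom.id _, ⊤, not_kerTopNormallyGeneratedBy_id_top _⟩

/-- **The universal closure of F-0214 is false** (instantiated at abc-iut-w5-d197's target
`Π := G_{ℚ_2} × F̂₂ ↠ G_{ℚ_2}`, `AbsTopI.TargetData.exists_slim_prod 2`, universe `0`).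
[cite: MochizukiAbsTopI2012, Def 4.2 (iii) p.50] -/
theorem not_forall_kerTopNormallyGeneratedBy :
    ¬ ∀ (E : FundamentalExtension.{0}) (L L' : E.ChainGroup) (φ : L.grp →ₜ* L'.grp) (A : Subgroup L.grp),
        KerTopNormallyGeneratedBy φ A := by
  intro h
  haveI : Fact (Nat.Prime 2) := ⟨Nat.prime_two⟩
  obtain ⟨F, -, -, -, hP, hΔ, hne, -⟩ := AbsTopI.TargetData.exists_slim_prod 2
  obtain ⟨L, φ, A, hL⟩ := exists_not_kerTopNormallyGeneratedBy hP hΔ hne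
  exact hL (h F L L φ A)

end ChainGroup

end FundamentalExtension

end Literature.AnabelianGeometry.AbsoluteAnabelian
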